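import Summits.QuantumAdvantage.QuantumAdvantage.Theses.CubicForrelation
import Literature.Computability.QuantumComplexity.PromiseBQPSubsetPromisePP
import Literature.Computability.QuantumComplexity.ForrelationDerivativeTables

/-!
# Crux `CubicForrelation.SignedCubicForrelationNotPrBPP` (stmt-QuantumAdvantage-13931) — line `Sketch`

Barrier certificate for the line's load-bearing stub `stub_terminalHard` (T): hardness of the
TERMINAL sub-family of signed cubic 2-fold Forrelation (both circuits computing kernel-free functions —
no direction `h ≠ 0` with an affine derivative) is SEPARATION-STRENGTH. Together with the route's
support item `SignedCubicForrelationMemPromiseBQP` (Aaronson–Ambainis 2018 §3.2 Prop. 6: the signed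
problem is in `PromiseBQP` by one Hadamard test) it proves `P ≠ PP` in the tree's classes, exactly as
the crux `X` itself does (`Cruxes/…/Disproof.lean` §1 `crux_imp_P_ne_PP`): the terminal sub-promise
is still in `PromiseBQP` (antitonicity, `mem_PromiseBQP_of_subset`), and a `PromiseBQP` problem
outside `PromiseBPP'` gives `P ≠ PP` (`P_ne_PP_of_promise_witness`, the promise form of
Adleman–DeMarrais–Huang). So T is not a proof target; it is the line's stuck stub by nature, and the
line's closable content is the kernel-descent engine (`descent_step`).
-/

noncomputable section

set_option linter.dupNamespace false -- D-0017: single-problem summit ⇒ QuantumAdvantage.QuantumAdvantage by design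

namespace Summit.QuantumAdvantage.QuantumAdvantage.Theorems.SignedCubicForrelationNotPrBPP

open Literature.Computability.QuantumComplexity Literature.Computability.Complexity
open Literature.Computability.Cryptography (PromiseBQP)
open Literature.Computability.QuantumComplexity.BuzetChailloux (bxor zeroVec)
open Summit.QuantumAdvantage.QuantumAdvantage.Theses.CubicForrelation

/-- **Registered sub-goal `terminalHard_imp_P_ne_PP`.** The terminal hardness hypothesis T of line
`Sketch`, together with the support item `SignedCubicForrelationMemPromiseBQP`, proves `P ≠ PP`. -/
theorem terminalHard_imp_P_ne_PP :
    SignedCubicForrelationMemPromiseBQP →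
    (⟨KForrelationInstance.encode ''
        {I | (I.IsYes ∧ I.k = 2 ∧ Even I.n ∧ ∀ i, IsDegLeFun 3 (I.C i).eval) ∧
          ∀ i, ¬ ∃ h : Fin I.n → Bool, h ≠ zeroVec ∧
            IsDegLeFun 1 (fun x => (I.C i).eval x ^^ (I.C i).eval (bxor x h))},
      KForrelationInstance.encode ''
        {I | ((I.IsOverB2 ∧ I.value ≤ -(3 / 5 : ℝ)) ∧ I.k = 2 ∧ Even I.n ∧
            ∀ i, IsDegLeFun 3 (I.C i).eval) ∧
          ∀ i, ¬ ∃ h : Fin I.n → Bool, h ≠ zeroVec ∧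
            IsDegLeFun 1 (fun x => (I.C i).eval x ^^ (I.C i).eval (bxor x h))}⟩ : PromiseProblem) ∉
      PromiseBPP' →
    Classes.P ≠ PP := by
  intro h34 hT
  refine P_ne_PP_of_promise_witness (mem_PromiseBQP_of_subset ?_ ?_ h34) hT
  · rintro _ ⟨I, ⟨hI, -⟩, rfl⟩
    exact ⟨I, hI, rfl⟩
  · rintro _ ⟨I, ⟨hI, -⟩, rfl⟩
    exact ⟨I, hI, rfl⟩

end Summit.QuantumAdvantage.QuantumAdvantage.Theorems.SignedCubicForrelationNotPrBPP

end
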